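import Literature.AlgebraicGeometry.GroupSchemes.StrictBirationalGroupLaw
import Literature.AlgebraicGeometry.NeronModels.GroupObjectOfShearIso
import HarnessLib

/-!
# An everywhere-defined birational group law with bijective shears is its own group chunk (Weil's theorem, terminal case)
# — [EdixhovenRomagny, Thm. 2.11 (2)–(5), Thm. 3.18 (2)] [Artin1986NeronModels, §2 after Lemma 2.5] [BLRNeronModels1990, §5.1]

Topic `Literature/AlgebraicGeometry/GroupSchemes`; THEOREMS ONLY (no definition / named fact / instance); net Literature debt 0.
Cell `hodgecm-mathlib` (D-0151), road W, node (W1) «group scheme out of a strict birational group law», STUB W1d first half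
(A-p06 READFIRST-W1 §3) in the vocabulary W1-D ★ `StrictBirationalGroupLaw` (A-p06): the case the gluing (W1c) hands over —
the law is defined on ALL of `𝒳 ×_S 𝒳` (`IsIso L.dom.ι`) and both shear maps `Φ : (a,b) ↦ (a,ab)`, `Ψ : (a,b) ↦ (ab,b)`
(open immersions by definition of a birational group law) are SURJECTIVE, hence isomorphisms; with a section
`e : 𝟙 ⟶ 𝒳` the object `𝒳` of `Over S` is then a GROUP scheme with multiplication the law
(`BirationalGroupLaw.exists_grpObj_of_isIso_ι`, via ★ `exists_grpObj_of_isIso_shear`: an associative law with invertible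
shears and a point is a group law), and `(𝒳, 𝟙)` is a group-chunk solution of `L` (`…isGroupChunkSolution_id`).
HC_CM is proved only modulo the 7 printed citations until rung 0 closes.
-/

noncomputable section

universe u

namespace Literature.AlgebraicGeometry.GroupSchemes

open CategoryTheory CategoryTheory.Limits _root_.AlgebraicGeometry MonoidalCategory CartesianMonoidalCategory
open MonObj GrpObj Literature.AlgebraicGeometry.NeronModels
open scoped CategoryTheory.Obj

namespace BirationalGroupLaw

variable {S : Scheme.{u}} {𝒳 : Over S} (L : BirationalGroupLaw 𝒳)

/-! ### §1 The law as a morphism `𝒳 ⊗ 𝒳 ⟶ 𝒳` when `dom = 𝒳 ×_S 𝒳` -/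

/-- When `dom ⊆ 𝒳 ×_S 𝒳` is everything, the inclusion `domOver ⟶ 𝒳 ⊗ 𝒳` is an isomorphism of `S`-schemes.
[cite: EdixhovenRomagny, Def. 3.4] -/
theorem isIso_inclOver [IsIso L.dom.ι] : IsIso (LawData.inclOver 𝒳 L.dom) := by
  haveI : IsIso ((Over.forget S).map (LawData.inclOver 𝒳 L.dom)) := by
    change IsIso L.dom.ι; infer_instance
  exact isIso_of_reflects_iso (LawData.inclOver 𝒳 L.dom) (Over.forget S)

/-- The everywhere-defined law `m = incl⁻¹ ≫ mul : 𝒳 ⊗ 𝒳 ⟶ 𝒳` satisfies `incl ≫ m = mul`. [cite: EdixhovenRomagny, Def. 3.4] -/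
theorem inclOver_comp_inv_comp_mulOver [IsIso L.dom.ι] :
    haveI := L.isIso_inclOver
    LawData.inclOver 𝒳 L.dom ≫ (inv (LawData.inclOver 𝒳 L.dom) ≫ L.mulOver) = L.mulOver := by
  rw [IsIso.hom_inv_id_assoc]

/-- The left shear of the law factors as `incl ≫ (pr₁, m)`. [cite: Artin1986NeronModels, (1.11) p. 217] -/
theorem shearLeft_eq [IsIso L.dom.ι] :
    haveI := L.isIso_inclOver
    L.shearLeft = LawData.inclOver 𝒳 L.dom ≫ lift (fst 𝒳 𝒳) (inv (LawData.inclOver 𝒳 L.dom) ≫ L.mulOver) := by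
  haveI := L.isIso_inclOver
  rw [comp_lift, IsIso.hom_inv_id_assoc]
  rfl

/-- The right shear of the law factors as `incl ≫ (m, pr₂)`. [cite: Artin1986NeronModels, (1.11) p. 217] -/
theorem shearRight_eq [IsIso L.dom.ι] :
    haveI := L.isIso_inclOver
    L.shearRight = LawData.inclOver 𝒳 L.dom ≫ lift (inv (LawData.inclOver 𝒳 L.dom) ≫ L.mulOver) (snd 𝒳 𝒳) := by
  haveI := L.isIso_inclOver
  rw [comp_lift, IsIso.hom_inv_id_assoc]
  rfl

/-- A SURJECTIVE shear map (an open immersion by definition of a birational group law) is an isomorphism of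
`S`-schemes. [cite: EdixhovenRomagny, Thm. 3.18 (2)] -/
theorem isIso_shearLeft (h : Function.Surjective L.shearLeft.left.base) : IsIso L.shearLeft := by
  haveI := L.isOpenImmersion_shearLeft
  haveI : Epi L.shearLeft.left.base := (TopCat.epi_iff_surjective _).mpr h
  haveI : IsIso L.shearLeft.left := IsOpenImmersion.isIso _
  haveI : IsIso ((Over.forget S).map L.shearLeft) := by change IsIso L.shearLeft.left; infer_instance
  exact isIso_of_reflects_iso L.shearLeft (Over.forget S)

/-- A SURJECTIVE right shear is an isomorphism of `S`-schemes. [cite: EdixhovenRomagny, Thm. 3.18 (2)] -/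
theorem isIso_shearRight (h : Function.Surjective L.shearRight.left.base) : IsIso L.shearRight := by
  haveI := L.isOpenImmersion_shearRight
  haveI : Epi L.shearRight.left.base := (TopCat.epi_iff_surjective _).mpr h
  haveI : IsIso L.shearRight.left := IsOpenImmersion.isIso _
  haveI : IsIso ((Over.forget S).map L.shearRight) := by change IsIso L.shearRight.left; infer_instance
  exact isIso_of_reflects_iso L.shearRight (Over.forget S)

/-! ### §2 The group structure -/

/-- **An everywhere-defined birational group law with surjective shears and a section is a group law** (terminal case of
Weil's group-chunk theorem; [EdixhovenRomagny] Thm. 2.11 (2)–(5) / 3.18 (2); [Artin1986NeronModels] §2, «the group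
structure on `V′` … exercise»): if `dom = 𝒳 ×_S 𝒳`, both shear maps are surjective, and `𝒳 → S` has a section, then
`𝒳` is a group object of `Over S` whose multiplication restricts to `mul` on `dom`.  Associativity of the everywhere-defined
law on `T`-valued points comes from `L.assoc` (all four products are defined); then ★ `exists_grpObj_of_isIso_shear`.
[cite: EdixhovenRomagny, Thm. 2.11 (2)-(5) and Thm. 3.18 (2)] [cite: Artin1986NeronModels, §2 (after Lemma 2.5) p. 223] -/
theorem exists_grpObj_of_isIso_ι [IsIso L.dom.ι] (hΦ : Function.Surjective L.shearLeft.left.base)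
    (hΨ : Function.Surjective L.shearRight.left.base) (e : 𝟙_ (Over S) ⟶ 𝒳) :
    ∃ _ : GrpObj 𝒳, L.dom.ι ≫ μ[𝒳].left = L.mul := by
  haveI := L.isIso_inclOver
  obtain ⟨m, hm⟩ : ∃ m : 𝒳 ⊗ 𝒳 ⟶ 𝒳, m = inv (LawData.inclOver 𝒳 L.dom) ≫ L.mulOver := ⟨_, rfl⟩
  -- the shears of `m` are isomorphisms
  haveI hΦ' : IsIso (lift (fst 𝒳 𝒳) m) := by
    haveI := L.isIso_shearLeft hΦ
    have h : lift (fst 𝒳 𝒳) m = inv (LawData.inclOver 𝒳 L.dom) ≫ L.shearLeft := by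
      rw [L.shearLeft_eq, IsIso.inv_hom_id_assoc, hm]
    rw [h]; infer_instance
  haveI hΨ' : IsIso (lift m (snd 𝒳 𝒳)) := by
    haveI := L.isIso_shearRight hΨ
    have h : lift m (snd 𝒳 𝒳) = inv (LawData.inclOver 𝒳 L.dom) ≫ L.shearRight := by
      rw [L.shearRight_eq, IsIso.inv_hom_id_assoc, hm]
    rw [h]; infer_instance
  -- associativity of `m` on `T`-valued points of `Over S`, from `L.assoc`
  have hassoc : ∀ {T : Over S} (a b c : T ⟶ 𝒳), lift (lift a b ≫ m) c ≫ m = lift a (lift b c ≫ m) ≫ m := by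
    intro T a b c
    -- witnesses in `dom` for the four products
    have hC : ∀ (x y : T ⟶ 𝒳), LawData.Computes 𝒳 L.dom L.mul (lift x y ≫ inv (LawData.inclOver 𝒳 L.dom)).left
        x.left y.left (lift x y ≫ m).left := by
      intro x y
      refine ⟨?_, ?_, ?_⟩
      · change ((lift x y ≫ inv (LawData.inclOver 𝒳 L.dom)) ≫ LawData.inclOver 𝒳 L.dom ≫ fst 𝒳 𝒳).left = x.left
        rw [Category.assoc, IsIso.inv_hom_id_assoc, lift_fst]
      · change ((lift x y ≫ inv (LawData.inclOver 𝒳 L.dom)) ≫ LawData.inclOver 𝒳 L.dom ≫ snd 𝒳 𝒳).left = y.left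
        rw [Category.assoc, IsIso.inv_hom_id_assoc, lift_snd]
      · change ((lift x y ≫ inv (LawData.inclOver 𝒳 L.dom)) ≫ L.mulOver).left = (lift x y ≫ m).left
        rw [Category.assoc, ← hm]
    have key := L.assoc (hC a b) (hC b c) (hC (lift a b ≫ m) c) (hC a (lift b c ≫ m))
    exact (Over.forget S).map_injective key
  obtain ⟨inst, hmul⟩ := exists_grpObj_of_isIso_shear m hassoc e
  refine ⟨inst, ?_⟩
  change (LawData.inclOver 𝒳 L.dom ≫ μ[𝒳]).left = (L.mulOver).left
  congr 1
  rw [hmul, hm, IsIso.hom_inv_id_assoc]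

/-- **… and `(𝒳, 𝟙)` is then a group-chunk solution of `L`** ([EdixhovenRomagny] Thm. 3.18 (ii)–(iii) in the terminal
case): the identity is an open immersion with fibrewise-dense image, it carries `mul` to the group law, and
`(a, b) ↦ a b⁻¹` is surjective (precompose with `x ↦ (x, e)`). [cite: EdixhovenRomagny, Thm. 3.18 (ii)-(iii)] -/
theorem isGroupChunkSolution_id [IsIso L.dom.ι] (hΦ : Function.Surjective L.shearLeft.left.base)
    (hΨ : Function.Surjective L.shearRight.left.base) (e : 𝟙_ (Over S) ⟶ 𝒳) :
    ∃ _ : GrpObj 𝒳, L.dom.ι ≫ μ[𝒳].left = L.mul ∧ IsGroupChunkSolution L 𝒳 (𝟙 𝒳) := by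
  obtain ⟨inst, hmul⟩ := L.exists_grpObj_of_isIso_ι hΦ hΨ e
  refine ⟨inst, hmul, ⟨?_, ?_, ?_, ?_⟩⟩
  · change IsOpenImmersion (𝟙 𝒳.left); infer_instance
  · have : Set.range (𝟙 𝒳 : 𝒳 ⟶ 𝒳).left.base = Set.univ := by
      change Set.range (𝟙 𝒳.left : 𝒳.left ⟶ 𝒳.left).base = Set.univ
      simp
    rw [this]
    exact IsFibrewiseDense.univ _
  · rw [← hmul]
    simp
  · -- `x ↦ (x, e) ↦ x e⁻¹ = x`: the division map has a right inverse on the nose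
    set d : 𝒳 ⊗ 𝒳 ⟶ 𝒳 := ((𝟙 𝒳) ⊗ₘ (𝟙 𝒳)) ≫ (𝒳 ◁ ι[𝒳]) ≫ μ[𝒳] with hd
    have hsec : lift (𝟙 𝒳) (toUnit 𝒳 ≫ η[𝒳]) ≫ d = 𝟙 𝒳 := by
      rw [hd]
      simp only [MonoidalCategory.tensorHom_id, MonoidalCategory.id_whiskerRight, Category.id_comp,
        lift_whiskerLeft_assoc, Category.assoc, GrpObj.one_inv, MonObj.lift_comp_one_right]
    intro x
    refine ⟨(lift (𝟙 𝒳) (toUnit 𝒳 ≫ η[𝒳])).left.base x, ?_⟩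
    rw [← Scheme.Hom.comp_apply, ← Over.comp_left, hsec]
    rfl

end BirationalGroupLaw

end Literature.AlgebraicGeometry.GroupSchemes

end
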